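import Mathlib
import HarnessLib
import Summits.Ventures.LatticeQCDFlow.Exactness.IMHMultipleTryExact
import Summits.Ventures.LatticeQCDFlow.Exactness.IMHMultiProposalMinorisation

/-!
# The multiple-try flow sampler converges from every start at rate `(1 − (m + 1)/(W + m))ᵗ` — the pool-selection sampler's guarantee with
# `2W` improved to `W`; at one proposal it is the independence sampler's `1 − 1/W`

HONEST FRAMING: exact (Metropolis-corrected) sampling algorithms for lattice gauge theory;
figures of merit are autocorrelation/cost numbers at stated couplings and volumes; no
continuum-physics claim.

Venture `LatticeQCDFlow` (cell pub-lqcd), topic `Exactness`; FANOUT row 30 (lean-1, GEN-42).  NEW WORK of the cell, sequel of this generation's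
`IMHMultipleTryExact` (def-free multiple-try kernel with independent flow proposals, `hP`), by the argument of GEN-41's
`IMHMultiProposalMinorisation` (drop nothing, bound both leave-one-out pool weights by `W + Σ_{i ≠ J} w(y_i)`, factorise one coordinate against the
rest, Jensen for `s ↦ (c + s)⁻¹`; the tree's `RefreshScan.uniformlyErgodic_of_minorised`).

## Setting
Normalised positive weight `w ≤ W` (`π = w·q` a probability law), `m + 1` fresh proposals per update, the multiple-try kernel `P` of
`IMHMultipleTryExact` (pool `Fin (m + 2)`).

## Results (no `sorry`, no new definitions)
* `looPoolWeight_succ_cons` — `S_{J+1}(x ∷ y) = w(x) + Σ_{i ≠ J} w(y_i)`; `sum_erase_eq_sum_succAbove` — `Σ_{i ≠ J} w(y_i) = Σ_i w(y_{J.succAbove i})`.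
* **`mtm_minorisation`** — `P(x, B) ≥ (m + 1)·(W + m)⁻¹·π(B)` FROM EVERY STATE (both `S_0` and `S_{J+1}` are `≤ W + Σ_{i ≠ J} w(y_i)`, so each term
  is `≥ w(y_J)1_B(y_J)/(W + Σ_{i≠J} w(y_i))`; then GEN-41's factorisation and Jensen with `c = W`); `mtm_smul_le` (measure form);
  **`mtm_uniformlyErgodic`** — `|μ₀Pᵗ(A) − π(A)| ≤ (1 − (m + 1)/(W + m))ᵗ` for every initial law.
Reading (gauge files): with a batch of `m + 1` flow proposals per update and a weight bound `W`, the multiple-try gauge sampler contracts total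
variation by at least `(m + 1)/(W + m)` per update from every start (pool selection: `(m + 1)/(2W + m)`); `m + 1 ≈ W` proposals already halve the
distance.  With `IMHMultiProposalStickingFloor`'s count this is tight up to constants: escaping a configuration of weight `W` costs `≈ W` proposals
however they are batched.  NOT CLAIMED: that the multiple-try rule beats pool selection in asymptotic variance (only the off-diagonal domination
of `IMHMultipleTryExact` §5 and this better worst-case constant).
-/

noncomputable section

namespace Summit.Ventures.LatticeQCDFlow.Exactness

open MeasureTheory ProbabilityTheory Function Finset
open scoped ENNReal

variable {Ω : Type*} [MeasurableSpace Ω] {q : Measure Ω} [IsProbabilityMeasure q] {w : Ω → ℝ} {m : ℕ}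

omit [MeasurableSpace Ω] in
/-- `S_{J+1}(x ∷ y) = w(x) + Σ_{i ≠ J} w(y_i)`: leaving out proposal `J` from the pool keeps the current state and the other proposals.
[ours, bookkeeping] -/
theorem looPoolWeight_succ_cons (x : Ω) (y : Fin (m + 1) → Ω) (J : Fin (m + 1)) :
    ∑ i ∈ univ.erase J.succ, ENNReal.ofReal (w (Fin.cons (α := fun _ : Fin (m + 2) => Ω) x y i)) =
      ENNReal.ofReal (w x) + ∑ i ∈ univ.erase J, ENNReal.ofReal (w (y i)) := by
  have h1 := Finset.add_sum_erase (univ : Finset (Fin (m + 2)))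
    (fun i => ENNReal.ofReal (w (Fin.cons (α := fun _ : Fin (m + 2) => Ω) x y i))) (mem_univ J.succ)
  have h2 := Finset.add_sum_erase (univ : Finset (Fin (m + 1))) (fun i => ENNReal.ofReal (w (y i))) (mem_univ J)
  rw [Fin.sum_univ_succ] at h1
  simp only [Fin.cons_zero, Fin.cons_succ] at h1
  -- `h1 : w(y_J) + S_{J+1} = w x + Σ_i w(y_i)`, `h2 : w(y_J) + Σ_{i≠J} w(y_i) = Σ_i w(y_i)`
  rw [← h2, ← add_assoc, add_comm (ENNReal.ofReal (w x)) (ENNReal.ofReal (w (y J))), add_assoc] at h1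
  exact (ENNReal.add_right_inj ENNReal.ofReal_ne_top).1 h1

omit [MeasurableSpace Ω] in
/-- `Σ_{i ≠ J} w(y_i) = Σ_i w(y_{J.succAbove i})`. [ours, bookkeeping] -/
theorem sum_erase_eq_sum_succAbove (y : Fin (m + 1) → Ω) (J : Fin (m + 1)) :
    ∑ i ∈ univ.erase J, ENNReal.ofReal (w (y i)) = ∑ i : Fin m, ENNReal.ofReal (w (y (J.succAbove i))) := by
  have h1 := Finset.add_sum_erase (univ : Finset (Fin (m + 1))) (fun i => ENNReal.ofReal (w (y i))) (mem_univ J)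
  rw [Fin.sum_univ_succAbove _ J] at h1
  exact (ENNReal.add_right_inj ENNReal.ofReal_ne_top).1 h1

/-- **`P(x, B) ≥ (m + 1)·(W + m)⁻¹·π(B)` FROM EVERY STATE** for the multiple-try kernel with `m + 1` fresh flow proposals and a normalised weight
`0 < w ≤ W`. [ours] -/
theorem mtm_minorisation (hw : Measurable w) (hw0 : ∀ y, 0 < w y) {W : ℝ} (hwW : ∀ y, w y ≤ W)
    [IsProbabilityMeasure (q.withDensity fun y => ENNReal.ofReal (w y))] (P : Kernel Ω Ω)
    (hP : ∀ (x : Ω) {B : Set Ω}, MeasurableSet B → P x B =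
      ∫⁻ y, ∑ J : Fin (m + 1), ENNReal.ofReal (w (Fin.cons (α := fun _ : Fin (m + 2) => Ω) x y J.succ)) *
          B.indicator (fun _ => (1 : ℝ≥0∞)) (Fin.cons (α := fun _ : Fin (m + 2) => Ω) x y J.succ) *
          min (∑ i ∈ univ.erase 0, ENNReal.ofReal (w (Fin.cons (α := fun _ : Fin (m + 2) => Ω) x y i)))⁻¹
            (∑ i ∈ univ.erase J.succ, ENNReal.ofReal (w (Fin.cons (α := fun _ : Fin (m + 2) => Ω) x y i)))⁻¹ ∂(Measure.pi fun _ : Fin (m + 1) => q) +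
        (1 - ∫⁻ y, ∑ J : Fin (m + 1), ENNReal.ofReal (w (Fin.cons (α := fun _ : Fin (m + 2) => Ω) x y J.succ)) *
          min (∑ i ∈ univ.erase 0, ENNReal.ofReal (w (Fin.cons (α := fun _ : Fin (m + 2) => Ω) x y i)))⁻¹
            (∑ i ∈ univ.erase J.succ, ENNReal.ofReal (w (Fin.cons (α := fun _ : Fin (m + 2) => Ω) x y i)))⁻¹ ∂(Measure.pi fun _ : Fin (m + 1) => q)) *
          B.indicator 1 x)
    (x : Ω) {B : Set Ω} (hB : MeasurableSet B) :
    ((m + 1 : ℕ) : ℝ≥0∞) * ENNReal.ofReal (W + m)⁻¹ * (q.withDensity fun y => ENNReal.ofReal (w y)) B ≤ P x B := by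
  set π : Measure Ω := q.withDensity fun y => ENNReal.ofReal (w y) with hπ
  set μ : Measure (Fin (m + 1) → Ω) := Measure.pi fun _ : Fin (m + 1) => q with hμ
  have hWpos : 0 < W := by
    obtain ⟨y⟩ := nonempty_of_isProbabilityMeasure q
    exact (hw0 y).trans_le (hwW y)
  have h1 : ∫ y, w y ∂q = 1 := by
    have hl : ∫⁻ y, ENNReal.ofReal (w y) ∂q = 1 := by
      have := (measure_univ : π Set.univ = 1)
      rwa [hπ, withDensity_apply _ MeasurableSet.univ, Measure.restrict_univ] at this
    rw [integral_eq_lintegral_of_nonneg_ae (ae_of_all _ fun y => (hw0 y).le) hw.aestronglyMeasurable, hl, ENNReal.toReal_one]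
  -- lower-bound integrand: `f(y_J)·g(y_{−J})`
  set f : Ω → ℝ≥0∞ := fun y => ENNReal.ofReal (w y) * B.indicator (fun _ => (1 : ℝ≥0∞)) y with hf
  set g : (Fin m → Ω) → ℝ≥0∞ := fun b => (ENNReal.ofReal W + ∑ i, ENNReal.ofReal (w (b i)))⁻¹ with hg
  have hfm : Measurable f := hw.ennreal_ofReal.mul (measurable_const.indicator hB)
  have hgm : Measurable g := (measurable_const.add (Finset.measurable_sum _ fun i _ => hw.ennreal_ofReal.comp (measurable_pi_apply i))).inv
  have hfint : ∫⁻ a, f a ∂q = π B := by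
    have : f = B.indicator fun y => ENNReal.ofReal (w y) := by
      funext y; by_cases hy : y ∈ B <;> simp [hf, hy]
    rw [this, lintegral_indicator hB, hπ, withDensity_apply _ hB]
  have hgint : ENNReal.ofReal (W + m)⁻¹ ≤ ∫⁻ b, g b ∂(Measure.pi fun _ : Fin m => q) :=
    lintegral_inv_add_sum_ge hw (fun y => (hw0 y).le) hwW h1 hWpos
  -- pointwise lower bound of the multiple-try integrand
  have hpt : ∀ y : Fin (m + 1) → Ω, ∑ J : Fin (m + 1), f (y J) * g (fun i => y (J.succAbove i)) ≤
      ∑ J : Fin (m + 1), ENNReal.ofReal (w (Fin.cons (α := fun _ : Fin (m + 2) => Ω) x y J.succ)) *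
          B.indicator (fun _ => (1 : ℝ≥0∞)) (Fin.cons (α := fun _ : Fin (m + 2) => Ω) x y J.succ) *
          min (∑ i ∈ univ.erase 0, ENNReal.ofReal (w (Fin.cons (α := fun _ : Fin (m + 2) => Ω) x y i)))⁻¹
            (∑ i ∈ univ.erase J.succ, ENNReal.ofReal (w (Fin.cons (α := fun _ : Fin (m + 2) => Ω) x y i)))⁻¹ := by
    intro y
    refine sum_le_sum fun J _ => ?_
    simp only [Fin.cons_succ, hf, hg]
    refine mul_le_mul' le_rfl (le_min ?_ ?_)
    · -- `S_0 = w(y_J) + Σ_{i≠J} w(y_i) ≤ W + Σ_{i≠J} w(y_i)`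
      refine ENNReal.inv_le_inv.2 ?_
      rw [looPoolWeight_zero_cons, ← Finset.add_sum_erase _ _ (mem_univ J), sum_erase_eq_sum_succAbove]
      exact add_le_add (ENNReal.ofReal_le_ofReal (hwW _)) le_rfl
    · -- `S_{J+1} = w(x) + Σ_{i≠J} w(y_i) ≤ W + Σ_{i≠J} w(y_i)`
      refine ENNReal.inv_le_inv.2 ?_
      rw [looPoolWeight_succ_cons, sum_erase_eq_sum_succAbove]
      exact add_le_add (ENNReal.ofReal_le_ofReal (hwW _)) le_rfl
  have hmeas : ∀ J : Fin (m + 1), Measurable fun y : Fin (m + 1) → Ω => f (y J) * g (fun i => y (J.succAbove i)) := fun J =>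
    (hfm.comp (measurable_pi_apply J)).mul (hgm.comp (measurable_pi_lambda _ fun i => measurable_pi_apply _))
  calc ((m + 1 : ℕ) : ℝ≥0∞) * ENNReal.ofReal (W + m)⁻¹ * π B
      = ∑ _J : Fin (m + 1), π B * ENNReal.ofReal (W + m)⁻¹ := by
        rw [sum_const, card_univ, Fintype.card_fin, nsmul_eq_mul]; ring
    _ ≤ ∑ J : Fin (m + 1), (∫⁻ a, f a ∂q) * ∫⁻ b, g b ∂(Measure.pi fun _ : Fin m => q) :=
        sum_le_sum fun J _ => by rw [hfint]; exact mul_le_mul' le_rfl hgint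
    _ = ∑ J : Fin (m + 1), ∫⁻ y, f (y J) * g (fun i => y (J.succAbove i)) ∂μ :=
        sum_congr rfl fun J _ => (lintegral_pi_coord_mul_eq q m J hfm hgm).symm
    _ = ∫⁻ y, ∑ J : Fin (m + 1), f (y J) * g (fun i => y (J.succAbove i)) ∂μ := (lintegral_finsetSum _ fun J _ => hmeas J).symm
    _ ≤ ∫⁻ y, ∑ J : Fin (m + 1), ENNReal.ofReal (w (Fin.cons (α := fun _ : Fin (m + 2) => Ω) x y J.succ)) *
          B.indicator (fun _ => (1 : ℝ≥0∞)) (Fin.cons (α := fun _ : Fin (m + 2) => Ω) x y J.succ) *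
          min (∑ i ∈ univ.erase 0, ENNReal.ofReal (w (Fin.cons (α := fun _ : Fin (m + 2) => Ω) x y i)))⁻¹
            (∑ i ∈ univ.erase J.succ, ENNReal.ofReal (w (Fin.cons (α := fun _ : Fin (m + 2) => Ω) x y i)))⁻¹ ∂μ := lintegral_mono hpt
    _ ≤ P x B := by rw [hP x hB]; exact le_self_add

/-- **THE MEASURE FORM**: `ε • π ≤ P(x, ·)` with `ε = (m + 1)·(W + m)⁻¹`. [ours] -/
theorem mtm_smul_le (hw : Measurable w) (hw0 : ∀ y, 0 < w y) {W : ℝ} (hwW : ∀ y, w y ≤ W)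
    [IsProbabilityMeasure (q.withDensity fun y => ENNReal.ofReal (w y))] (P : Kernel Ω Ω)
    (hP : ∀ (x : Ω) {B : Set Ω}, MeasurableSet B → P x B =
      ∫⁻ y, ∑ J : Fin (m + 1), ENNReal.ofReal (w (Fin.cons (α := fun _ : Fin (m + 2) => Ω) x y J.succ)) *
          B.indicator (fun _ => (1 : ℝ≥0∞)) (Fin.cons (α := fun _ : Fin (m + 2) => Ω) x y J.succ) *
          min (∑ i ∈ univ.erase 0, ENNReal.ofReal (w (Fin.cons (α := fun _ : Fin (m + 2) => Ω) x y i)))⁻¹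
            (∑ i ∈ univ.erase J.succ, ENNReal.ofReal (w (Fin.cons (α := fun _ : Fin (m + 2) => Ω) x y i)))⁻¹ ∂(Measure.pi fun _ : Fin (m + 1) => q) +
        (1 - ∫⁻ y, ∑ J : Fin (m + 1), ENNReal.ofReal (w (Fin.cons (α := fun _ : Fin (m + 2) => Ω) x y J.succ)) *
          min (∑ i ∈ univ.erase 0, ENNReal.ofReal (w (Fin.cons (α := fun _ : Fin (m + 2) => Ω) x y i)))⁻¹
            (∑ i ∈ univ.erase J.succ, ENNReal.ofReal (w (Fin.cons (α := fun _ : Fin (m + 2) => Ω) x y i)))⁻¹ ∂(Measure.pi fun _ : Fin (m + 1) => q)) *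
          B.indicator 1 x)
    (x : Ω) :
    (((m + 1 : ℕ) : ℝ≥0∞) * ENNReal.ofReal (W + m)⁻¹) • (q.withDensity fun y => ENNReal.ofReal (w y)) ≤ P x := by
  refine Measure.le_iff.2 fun B hB => ?_
  rw [Measure.smul_apply, smul_eq_mul]
  exact mtm_minorisation hw hw0 hwW P hP x hB

/-- **THE MULTIPLE-TRY FLOW SAMPLER IS UNIFORMLY ERGODIC AT RATE `(1 − (m + 1)/(W + m))ᵗ`** from every initial law. [ours] -/
theorem mtm_uniformlyErgodic (hw : Measurable w) (hw0 : ∀ y, 0 < w y) {W : ℝ} (hwW : ∀ y, w y ≤ W)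
    [IsProbabilityMeasure (q.withDensity fun y => ENNReal.ofReal (w y))] (P : Kernel Ω Ω)
    (hP : ∀ (x : Ω) {B : Set Ω}, MeasurableSet B → P x B =
      ∫⁻ y, ∑ J : Fin (m + 1), ENNReal.ofReal (w (Fin.cons (α := fun _ : Fin (m + 2) => Ω) x y J.succ)) *
          B.indicator (fun _ => (1 : ℝ≥0∞)) (Fin.cons (α := fun _ : Fin (m + 2) => Ω) x y J.succ) *
          min (∑ i ∈ univ.erase 0, ENNReal.ofReal (w (Fin.cons (α := fun _ : Fin (m + 2) => Ω) x y i)))⁻¹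
            (∑ i ∈ univ.erase J.succ, ENNReal.ofReal (w (Fin.cons (α := fun _ : Fin (m + 2) => Ω) x y i)))⁻¹ ∂(Measure.pi fun _ : Fin (m + 1) => q) +
        (1 - ∫⁻ y, ∑ J : Fin (m + 1), ENNReal.ofReal (w (Fin.cons (α := fun _ : Fin (m + 2) => Ω) x y J.succ)) *
          min (∑ i ∈ univ.erase 0, ENNReal.ofReal (w (Fin.cons (α := fun _ : Fin (m + 2) => Ω) x y i)))⁻¹
            (∑ i ∈ univ.erase J.succ, ENNReal.ofReal (w (Fin.cons (α := fun _ : Fin (m + 2) => Ω) x y i)))⁻¹ ∂(Measure.pi fun _ : Fin (m + 1) => q)) *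
          B.indicator 1 x)
    (μ₀ : Measure Ω) [IsProbabilityMeasure μ₀] (t : ℕ) (A : Set Ω) :
    |((fun ν : Measure Ω => ν.bind P)^[t] μ₀).real A - (q.withDensity fun y => ENNReal.ofReal (w y)).real A| ≤
      (1 - (m + 1) / (W + m)) ^ t := by
  set π : Measure Ω := q.withDensity fun y => ENNReal.ofReal (w y) with hπ
  haveI : IsMarkovKernel P := ⟨fun x => ⟨mtm_apply_univ hw0 P hP x⟩⟩
  have hinv : Kernel.Invariant P π := by
    show π.bind P = π
    ext B hB
    rw [Measure.bind_apply hB (Kernel.aemeasurable _)]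
    exact mtm_invariant hw hw0 P hP hB
  have hWpos : 0 < W := by
    obtain ⟨y⟩ := nonempty_of_isProbabilityMeasure q
    exact (hw0 y).trans_le (hwW y)
  have h := uniformlyErgodic_of_minorised (mtm_smul_le hw hw0 hwW P hP) hinv μ₀ t A
  have hε : (((m + 1 : ℕ) : ℝ≥0∞) * ENNReal.ofReal (W + m)⁻¹).toReal = (m + 1) / (W + m) := by
    rw [ENNReal.toReal_mul, ENNReal.toReal_natCast, ENNReal.toReal_ofReal (inv_nonneg.2 (by positivity)), div_eq_mul_inv]
    push_cast; ring
  rwa [hε] at h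

end Summit.Ventures.LatticeQCDFlow.Exactness
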